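import Summits.Parity.GeneralizedHardyLittlewood.Theorems.GreenTaoLevelTwoMNTwoUniformMajorArcRotation
import Summits.Parity.GeneralizedHardyLittlewood.Theorems.GreenTaoLevelTwoMNTwoDenseDiagonal

/-!
# Route `GreenTaoLevelTwo`, crux `MNTwo` (stmt-Parity-21276), line `birth`, stub `stub_mnVertical`:
# §11 complete, parametric form: from the conclusion of Prop. 22 at one scale to ONE `q` on `B(ρ₃)`

Block V5 / H5 + H6 of the `stub_mnVertical` census (B. Green, T. Tao, *Quadratic uniformity of
the Möbius function*, Ann. Inst. Fourier 58 (2008) = arXiv:math/0606087, §11).  This def-free file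
composes Proposition 25 (`…MNTwoDenseDiagonal.dense_diagonal_set`) with the rotation-gauge §11
chain (`…MNTwoUniformMajorArcRotation.uniform_major_arc_rotation` = Lemmas 26, 27, 28): the INPUT
is the conclusion of Proposition 22 at the single scale `X = 1/ρ₁` — a set of divisors
`𝒟 ⊆ [1,D]` such that `φ''(n,n)` is major arc (`∃ 1 ≤ q ≤ Q, ‖q•φ''(n,n)‖ ≤ ε`) at every multiple
`n` of every `d ∈ 𝒟` inside the rotation Bohr set `B(ρ₁)` — and the OUTPUT is one `q` with
`‖q•φ''(a,b)‖ ≤ K ν(a)ν(b)` on all of `B(ρ₂/C_k)`, i.e. the shape of the conclusion of the tree's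
major-arc inverse statement (`…MNTwoVerticalOfInverseLargeN`, hypothesis `hInv`).  All parameters
(`ρ₁, Q, ε, D, 𝒟, r, ρ₂`) are free, subject to the explicit inequalities; the density
`σ = (2·32·38ᵏ·D)⁻²·#𝒟²·(4·32·38ᵏ)⁻¹·((ρ₁/16)^{k+1}/(8(1+log N)^{4^r}))^{1/r}` of Proposition 25
enters through the hypothesis `σ = …` (one occurrence).  What remains for the `hInv` target is
(i) Proposition 22 itself (§10, the other lineage) and (ii) the choice `ρ₁, ρ₂ = log^{-C(A+1)}N`
with the logarithmic bookkeeping.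

* `density_le_one`, `density_pos` — `0 < σ ≤ 1`;
* `majorArc_of_divisors` — the composition.

References: [GreenTao2008QuadraticMobius] arXiv:math/0606087 §11 (Prop. 25, Lemmas 26–28).
-/

noncomputable section

open Finset Real

namespace Summit.Parity.GeneralizedHardyLittlewood.GreenTaoLevelTwoMNTwoMajorArcOfDivisors

open Summit.Parity.GeneralizedHardyLittlewood.GreenTaoLevelTwoMNTwoUniformMajorArcRotation
  (uniform_major_arc_rotation)
open Summit.Parity.GeneralizedHardyLittlewood.GreenTaoLevelTwoMNTwoDenseDiagonal
  (dense_diagonal_set)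
open Summit.Parity.GeneralizedHardyLittlewood.GreenTaoLevelTwoMNTwoBohrGauge (bohrGauge_lt_iff)

/-- The Proposition-25 density is at most `1`. [folklore] -/
theorem density_le_one (k : ℕ) {N : ℕ} (hN : 1 ≤ N) {ρ₁ : ℝ} (hρ : 0 < ρ₁) (hρ4 : ρ₁ ≤ 1 / 4)
    {D : ℕ} (hD : 1 ≤ D) (𝒟 : Finset ℕ) (h𝒟 : 𝒟 ⊆ Icc 1 D) {r : ℕ} (hr : 1 ≤ r) :
    (1 / (2 * (32 * 38 ^ k) * (D : ℝ))) ^ 2 * (#𝒟 : ℝ) ^ 2 * (1 / (4 * (32 * 38 ^ k))) *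
        (((ρ₁ / 16) ^ (k + 1) / 8) / (1 + Real.log N) ^ (4 ^ r)) ^ ((1 : ℝ) / r) ≤ 1 := by
  have hDpos : (0 : ℝ) < D := by exact_mod_cast hD
  have hlog : (1 : ℝ) ≤ 1 + Real.log N := by
    have : (1 : ℝ) ≤ N := by exact_mod_cast hN
    linarith [Real.log_nonneg this]
  have h38 : (1 : ℝ) ≤ 38 ^ k := one_le_pow₀ (by norm_num)
  have hcard : (#𝒟 : ℝ) ≤ D := by
    have := card_le_card h𝒟
    rw [Nat.card_Icc] at this
    exact_mod_cast (by omega : #𝒟 ≤ D)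
  -- first factor ≤ 1
  have h1 : (1 / (2 * (32 * 38 ^ k) * (D : ℝ))) ^ 2 * (#𝒟 : ℝ) ^ 2 ≤ 1 := by
    rw [← mul_pow]
    have h : 1 / (2 * (32 * 38 ^ k) * (D : ℝ)) * #𝒟 ≤ 1 := by
      rw [one_div, inv_mul_le_iff₀ (by positivity)]
      nlinarith
    have h0 : 0 ≤ 1 / (2 * (32 * 38 ^ k) * (D : ℝ)) * #𝒟 := by positivity
    nlinarith
  have h2 : 1 / (4 * (32 * (38 : ℝ) ^ k)) ≤ 1 := by
    rw [div_le_one (by positivity)]; nlinarith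
  have h3 : (((ρ₁ / 16) ^ (k + 1) / 8) / (1 + Real.log N) ^ (4 ^ r)) ^ ((1 : ℝ) / r) ≤ 1 := by
    apply Real.rpow_le_one (by positivity) _ (by positivity)
    rw [div_le_one (by positivity)]
    have h4 : (ρ₁ / 16) ^ (k + 1) ≤ 1 := pow_le_one₀ (by positivity) (by linarith)
    have h5 : (1 : ℝ) ≤ (1 + Real.log N) ^ (4 ^ r) := one_le_pow₀ hlog
    linarith
  have h0a : 0 ≤ (1 / (2 * (32 * 38 ^ k) * (D : ℝ))) ^ 2 * (#𝒟 : ℝ) ^ 2 := by positivity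
  have h0b : 0 ≤ 1 / (4 * (32 * (38 : ℝ) ^ k)) := by positivity
  have h0c : 0 ≤ (((ρ₁ / 16) ^ (k + 1) / 8) / (1 + Real.log N) ^ (4 ^ r)) ^ ((1 : ℝ) / r) := by
    positivity
  calc (1 / (2 * (32 * 38 ^ k) * (D : ℝ))) ^ 2 * (#𝒟 : ℝ) ^ 2 * (1 / (4 * (32 * 38 ^ k))) *
        (((ρ₁ / 16) ^ (k + 1) / 8) / (1 + Real.log N) ^ (4 ^ r)) ^ ((1 : ℝ) / r)
      ≤ 1 * 1 * 1 :=
        mul_le_mul (mul_le_mul h1 h2 h0b zero_le_one) h3 h0c (by norm_num)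
    _ = 1 := by ring

/-- The Proposition-25 density is positive when `𝒟` is nonempty. [folklore] -/
theorem density_pos (k : ℕ) {N : ℕ} (hN : 1 ≤ N) {ρ₁ : ℝ} (hρ : 0 < ρ₁)
    {D : ℕ} (hD : 1 ≤ D) (𝒟 : Finset ℕ) (h𝒟1 : 1 ≤ #𝒟) (r : ℕ) :
    0 < (1 / (2 * (32 * 38 ^ k) * (D : ℝ))) ^ 2 * (#𝒟 : ℝ) ^ 2 * (1 / (4 * (32 * 38 ^ k))) *
        (((ρ₁ / 16) ^ (k + 1) / 8) / (1 + Real.log N) ^ (4 ^ r)) ^ ((1 : ℝ) / r) := by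
  have hDpos : (0 : ℝ) < D := by exact_mod_cast hD
  have hlog : (0 : ℝ) < 1 + Real.log N := by
    have : (1 : ℝ) ≤ N := by exact_mod_cast hN
    linarith [Real.log_nonneg this]
  have hcard : (0 : ℝ) < #𝒟 := by exact_mod_cast h𝒟1
  have h3 : 0 < (((ρ₁ / 16) ^ (k + 1) / 8) / (1 + Real.log N) ^ (4 ^ r)) ^ ((1 : ℝ) / r) :=
    Real.rpow_pos_of_pos (by positivity) _
  positivity

/-- **GT 2008b §11, parametric form: Prop. 22 at one scale ⇒ one `q` on `B(ρ₃)`.**  There are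
absolute `A ∈ ℕ`, `C ≥ 1` such that the following holds.  Let `N ≥ 1`, `α : Fin k → ℝ`,
`φ : ℤ → ℝ/ℤ` locally quadratic on the gauge ball `B(n₀,R)` (`ν(n) = maxᵢ‖nαᵢ‖ + |n|/N`);
`0 < ρ₁ ≤ 1/4`, `9ρ₁ ≤ R`, `1 ≤ Q`, `0 ≤ ε`; `1 ≤ D`, `𝒟 ⊆ [1,D]` nonempty with
`4·32·38ᵏ·D ≤ (ρ₁/16)^{k+1}N/2`, such that for every `d ∈ 𝒟` and every multiple `n` of `d` in the
rotation Bohr set `B(ρ₁) ∩ (−N,N)` there is `1 ≤ q ≤ Q` with `‖q•φ''(n,n)‖ ≤ ε` (the conclusion of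
Proposition 22 at `X = 1/ρ₁`); `r ≥ 1`; `σ` the Prop-25 density with `4Qε ≤ σ`; `0 < ρ₂`,
`18ρ₂ ≤ R`, `648Q₁³K₁ρ₂² ≤ 1` (`Q₁ = CQ(Q/σ)^A`, `K₁ = C(Q/σ)^A/ρ₁²`).  Then there is ONE
`1 ≤ q ≤ (25672Q₁⁶)^{(k+1)²}` with
`‖q•φ''(a,b)‖ ≤ (25672Q₁⁶)^{(k+1)²}(426133840896·Q₁¹³K₁)C_k² ν(a)ν(b)` for all `a, b ∈ B(ρ₂/C_k)`,
`C_k = 5(k+1)²2^{(k+1)(k+3)}`. [cite: GreenTao2008QuadraticMobius, §11, Prop. 25 and Lemmas 26–28] -/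
theorem majorArc_of_divisors :
    ∃ (A : ℕ) (C : ℝ), 1 ≤ C ∧
      ∀ (k N : ℕ), 1 ≤ N → ∀ (α : Fin k → ℝ) (φ : ℤ → UnitAddCircle) (n₀ : ℤ) (R : ℝ),
        (∀ n a b c : ℤ,
          (⨆ i : Fin k, ‖((((n - n₀ : ℤ) : ℝ) * α i : ℝ) : AddCircle (1 : ℝ))‖) +
              |((n - n₀ : ℤ) : ℝ)| / N < R →
          (⨆ i : Fin k, ‖((((n + a - n₀ : ℤ) : ℝ) * α i : ℝ) : AddCircle (1 : ℝ))‖) +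
              |((n + a - n₀ : ℤ) : ℝ)| / N < R →
          (⨆ i : Fin k, ‖((((n + b - n₀ : ℤ) : ℝ) * α i : ℝ) : AddCircle (1 : ℝ))‖) +
              |((n + b - n₀ : ℤ) : ℝ)| / N < R →
          (⨆ i : Fin k, ‖((((n + c - n₀ : ℤ) : ℝ) * α i : ℝ) : AddCircle (1 : ℝ))‖) +
              |((n + c - n₀ : ℤ) : ℝ)| / N < R →
          (⨆ i : Fin k, ‖((((n + a + b - n₀ : ℤ) : ℝ) * α i : ℝ) : AddCircle (1 : ℝ))‖) +
              |((n + a + b - n₀ : ℤ) : ℝ)| / N < R →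
          (⨆ i : Fin k, ‖((((n + a + c - n₀ : ℤ) : ℝ) * α i : ℝ) : AddCircle (1 : ℝ))‖) +
              |((n + a + c - n₀ : ℤ) : ℝ)| / N < R →
          (⨆ i : Fin k, ‖((((n + b + c - n₀ : ℤ) : ℝ) * α i : ℝ) : AddCircle (1 : ℝ))‖) +
              |((n + b + c - n₀ : ℤ) : ℝ)| / N < R →
          (⨆ i : Fin k, ‖((((n + a + b + c - n₀ : ℤ) : ℝ) * α i : ℝ) : AddCircle (1 : ℝ))‖) +
              |((n + a + b + c - n₀ : ℤ) : ℝ)| / N < R →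
          φ (n + a + b + c) - φ (n + a + b) - φ (n + a + c) - φ (n + b + c)
            + φ (n + a) + φ (n + b) + φ (n + c) - φ n = 0) →
      ∀ (ρ₁ ε Q : ℝ), 0 < ρ₁ → ρ₁ ≤ 1 / 4 → 9 * ρ₁ ≤ R → 1 ≤ Q → 0 ≤ ε →
      ∀ (D : ℕ), 1 ≤ D → ∀ (𝒟 : Finset ℕ), 𝒟 ⊆ Icc 1 D → 1 ≤ #𝒟 →
        4 * (32 * 38 ^ k) * (D : ℝ) ≤ (ρ₁ / 16) ^ (k + 1) * N / 2 →
        (∀ d ∈ 𝒟, ∀ n ∈ (Finset.Ioo (-(N : ℤ)) N).filter fun n : ℤ =>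
            (∀ i, ‖(((n : ℝ) * α i : ℝ) : AddCircle (1 : ℝ))‖ + |(n : ℝ)| / N < ρ₁) ∧
              |(n : ℝ)| / N < ρ₁,
          (d : ℤ) ∣ n → ∃ q : ℕ, 1 ≤ q ∧ (q : ℝ) ≤ Q ∧
            ‖((q : ℤ)) • (φ (n₀ + n + n) - φ (n₀ + n) - φ (n₀ + n) + φ n₀)‖ ≤ ε) →
      ∀ (r : ℕ), 1 ≤ r → ∀ (σ : ℝ),
        σ = (1 / (2 * (32 * 38 ^ k) * (D : ℝ))) ^ 2 * (#𝒟 : ℝ) ^ 2 * (1 / (4 * (32 * 38 ^ k))) *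
          (((ρ₁ / 16) ^ (k + 1) / 8) / (1 + Real.log N) ^ (4 ^ r)) ^ ((1 : ℝ) / r) →
        4 * Q * ε ≤ σ →
      ∀ (ρ₂ : ℝ), 0 < ρ₂ → 18 * ρ₂ ≤ R →
        648 * (C * Q * (Q / σ) ^ A) ^ 3 * (C * (Q / σ) ^ A / ρ₁ ^ 2) * ρ₂ ^ 2 ≤ 1 →
      ∃ q : ℕ, 1 ≤ q ∧ (q : ℝ) ≤ (25672 * (C * Q * (Q / σ) ^ A) ^ 6) ^ ((k + 1) * (k + 1)) ∧
        ∀ a b : ℤ,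
          (⨆ i : Fin k, ‖(((a : ℝ) * α i : ℝ) : AddCircle (1 : ℝ))‖) + |(a : ℝ)| / N <
            ρ₂ / (5 * ((k : ℝ) + 1) ^ 2 * 2 ^ ((k + 1) * (k + 3))) →
          (⨆ i : Fin k, ‖(((b : ℝ) * α i : ℝ) : AddCircle (1 : ℝ))‖) + |(b : ℝ)| / N <
            ρ₂ / (5 * ((k : ℝ) + 1) ^ 2 * 2 ^ ((k + 1) * (k + 3))) →
          ‖((q : ℤ)) • (φ (n₀ + a + b) - φ (n₀ + a) - φ (n₀ + b) + φ n₀)‖ ≤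
            (25672 * (C * Q * (Q / σ) ^ A) ^ 6) ^ ((k + 1) * (k + 1)) *
              (426133840896 * (C * Q * (Q / σ) ^ A) ^ 13 * (C * (Q / σ) ^ A / ρ₁ ^ 2)) *
              (5 * ((k : ℝ) + 1) ^ 2 * 2 ^ ((k + 1) * (k + 3))) ^ 2 *
              ((⨆ i : Fin k, ‖(((a : ℝ) * α i : ℝ) : AddCircle (1 : ℝ))‖) + |(a : ℝ)| / N) *
              ((⨆ i : Fin k, ‖(((b : ℝ) * α i : ℝ) : AddCircle (1 : ℝ))‖) + |(b : ℝ)| / N) := by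
  classical
  obtain ⟨A, C, hC1, hrot⟩ := uniform_major_arc_rotation
  refine ⟨A, C, hC1, ?_⟩
  intro k N hN α φ n₀ R hφ ρ₁ ε Q hρ₁ hρ₁4 hR9 hQ hε D hD 𝒟 h𝒟 h𝒟1 hlarge hgood r hr σ hσdef hQε
    ρ₂ hρ₂ hR18 hsmall
  -- the set `𝒮` of good elements of `B(ρ₁)`
  set B₁ := (Finset.Ioo (-(N : ℤ)) N).filter fun n : ℤ =>
    (∀ i, ‖(((n : ℝ) * α i : ℝ) : AddCircle (1 : ℝ))‖ + |(n : ℝ)| / N < ρ₁) ∧ |(n : ℝ)| / N < ρ₁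
    with hB₁
  obtain ⟨good, hgood_def⟩ : ∃ good : ℤ → Prop, ∀ n, good n ↔ ∃ q : ℕ, 1 ≤ q ∧ (q : ℝ) ≤ Q ∧
      ‖((q : ℤ)) • (φ (n₀ + n + n) - φ (n₀ + n) - φ (n₀ + n) + φ n₀)‖ ≤ ε := ⟨_, fun _ => Iff.rfl⟩
  set S := B₁.filter good with hSdef
  -- Proposition 25
  have hdense := dense_diagonal_set k hN α hρ₁ hρ₁4 hD 𝒟 h𝒟 hlarge good
    (fun d hd n hn hdn => (hgood_def n).2 (hgood d hd n hn hdn)) hr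
  have hσ : 0 < σ := by rw [hσdef]; exact density_pos k hN hρ₁ hD 𝒟 h𝒟1 r
  have hσ1 : σ ≤ 1 := by rw [hσdef]; exact density_le_one k hN hρ₁ hρ₁4 hD 𝒟 h𝒟 hr
  have hSball : ∀ s ∈ S,
      (⨆ i : Fin k, ‖(((s : ℝ) * α i : ℝ) : AddCircle (1 : ℝ))‖) + |(s : ℝ)| / N < ρ₁ := by
    intro s hs
    rw [hSdef, Finset.mem_filter, hB₁, Finset.mem_filter] at hs
    exact (bohrGauge_lt_iff α N s ρ₁).2 hs.1.2
  have hS : ∀ s ∈ S, ∃ q : ℕ, 1 ≤ q ∧ (q : ℝ) ≤ Q ∧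
      ‖((q : ℤ)) • (φ (n₀ + s + s) - φ (n₀ + s) - φ (n₀ + s) + φ n₀)‖ ≤ ε := by
    intro s hs
    rw [hSdef, Finset.mem_filter] at hs
    exact (hgood_def s).1 hs.2
  have hσT : σ * #((Finset.Ioo (-(N : ℤ)) N).filter fun n : ℤ =>
      (∀ i, ‖(((n : ℝ) * α i : ℝ) : AddCircle (1 : ℝ))‖ + |(n : ℝ)| / N < 2 * ρ₁) ∧
        |(n : ℝ)| / N < 2 * ρ₁) ≤ #S := by
    refine le_trans (le_of_eq ?_) hdense
    rw [hσdef]; ring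
  exact hrot k N hN α φ n₀ R hφ ρ₁ σ ε Q S hρ₁ hρ₁4 hR9 hσ hσ1 hQ hε hQε hSball hσT hS ρ₂ hρ₂ hR18
    hsmall

end Summit.Parity.GeneralizedHardyLittlewood.GreenTaoLevelTwoMNTwoMajorArcOfDivisors
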